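import Literature.NumberTheory.GaloisRepresentations.SerreSubgroupsGL2Fp
import Literature.NumberTheory.GaloisRepresentations.SerreOpenImageGroupLemmas
import HarnessLib

/-!
# Serre 1972, §2.6: a maximal torus of index `2` in its normaliser, and the `SL₂`-criterion behind
# Masser–Wüstholz 1993 §4 in "normaliser" form

Topic `NumberTheory/GaloisRepresentations`; theorems only (no definitions, no named facts), a
sequel to `SerreSubgroupsGL2FpPrimeToP` (n° 2.6 of J.-P. Serre, *Propriétés galoisiennes des
points d'ordre fini des courbes elliptiques*, Invent. Math. 15 (1972)) and to
`SerreCartanSubgroupsGL2FpProofs`.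

* `Serre1972.Counting.exists_card_normalizer_centralizer_eq_two_mul` — the class equation of the
  maximal tori (`Counting.card_eq_and_card_centralizer_le`, whose set-up is repeated verbatim)
  also shows: if every torus has index `≥ 3`, **some maximal torus `T = C_G(x)` has index `2` in
  its normaliser and `[G : N_G(T)] ≤ 15`** (in the tetrahedral, octahedral and icosahedral
  solutions `(n; (aᵢ, eᵢ, cᵢ)) = (12; (3,1,4), (2,2,3))`, `(24; (2,2,6), (3,2,4), (4,2,3))`,
  `(60; (2,2,15), (3,2,10), (5,2,6))` some class has `e = 2`, and then `c = n / (2a) ≤ 15`).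
* `Serre1972.exists_card_normalizer_centralizer_eq_two_mul` — the same for every non-abelian
  `G ≤ GL₂(𝔽_p)` of order prime to `p` (`p` odd): in case ii) of n° 2.6 the normal torus itself.
* `Serre1972.map_normalizer_centralizer_le_normalizer` — `N_G(C_G(x)) ⊆ N(𝔽_p[x]ˣ)` for a
  non-scalar `x` (as in `le_normalizer_unitGroup_adjoinElem`).
* `Serre1972.ker_det_le_of_forall_le_normalizer_imp_le` — **the `SL₂`-criterion**: let `p` be odd
  and `G ≤ GL₂(𝔽_p)` fix no line, contain an element `c` with `c² = 1`, `det c = -1`, and have the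
  property that every subgroup `H ≤ G` of index `≤ 60` contained in the normaliser of a Cartan
  subgroup `C` is contained in `C`.  Then `G ⊇ SL₂(𝔽_p)`.  (Prop. 15 if `p ∣ |G|`; if `p ∤ |G|`:
  `G` abelian lies in the Cartan subgroup `𝔽_p[c]ˣ`, hence in a Borel subgroup
  (`exists_le_eigenvectorStabilizer_of_le_cartan`); otherwise `H = N_G(T)` for the torus above
  normalises the Cartan subgroup `𝔽_p[x]ˣ ⊇ T` without being inside it.)  This is the group
  theory of Masser–Wüstholz, Bull. LMS 25 (1993) §4 with the commutativity hypothesis on subgroups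
  of index `≤ 60` replaced by the dihedral-type hypothesis that is refuted by quadratic twisting
  (Serre 1972 §4.2 c)).

## References

* [Serre1972] J.-P. Serre, Invent. Math. 15 (1972) 259–331, §2.5 Prop. 16, §2.6, §4.2 c).
* D. Masser, G. Wüstholz, Bull. London Math. Soc. 25 (1993) 247–254, §4.
-/

open Matrix
open scoped MatrixGroups

/-! ## The class equation, with the index of a torus in its normaliser -/

namespace Literature.NumberTheory.GaloisRepresentations.Serre1972.Counting

open Subgroup MulAction
open scoped Pointwise
open Literature.NumberTheory.GaloisRepresentations.DeligneSerre1974.Counting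

variable {n : ℕ}

/-- Two classes of tori of index `≥ 3`: one of them has index `2` in its normaliser (`e = 2`).
[folklore] -/
lemma exists_e_eq_two_of_two {p₁ c₁ a₁ e₁ p₂ c₂ a₂ e₂ : ℕ}
    (h₁ : (p₁ = c₁ * a₁ ∧ n = e₁ * p₁ ∧ (e₁ = 1 ∨ e₁ = 2) ∧ 2 ≤ a₁ ∧ 3 * a₁ ≤ n))
    (h₂ : (p₂ = c₂ * a₂ ∧ n = e₂ * p₂ ∧ (e₂ = 1 ∨ e₂ = 2) ∧ 2 ≤ a₂ ∧ 3 * a₂ ≤ n))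
    (hs : n = 1 + (p₁ - c₁) + (p₂ - c₂)) : e₁ = 2 ∨ e₂ = 2 := by
  have hc₁ := two_le_of_tca h₁
  have hc₂ := two_le_of_tca h₂
  have k₁ := two_mul_le_of_tca h₁
  have k₂ := two_mul_le_of_tca h₂
  obtain ⟨-, hn₁, he₁, -, -⟩ := h₁
  obtain ⟨-, hn₂, he₂, -, -⟩ := h₂
  rcases he₁ with rfl | rfl
  · rcases he₂ with rfl | rfl
    · omega
    · exact Or.inr rfl
  · exact Or.inl rfl

/-- Three classes of tori of index `≥ 3`: every class has index `2` in its normaliser.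
[folklore] -/
lemma e_eq_two_of_three {p₁ c₁ a₁ e₁ p₂ c₂ a₂ e₂ p₃ c₃ a₃ e₃ : ℕ}
    (h₁ : (p₁ = c₁ * a₁ ∧ n = e₁ * p₁ ∧ (e₁ = 1 ∨ e₁ = 2) ∧ 2 ≤ a₁ ∧ 3 * a₁ ≤ n))
    (h₂ : (p₂ = c₂ * a₂ ∧ n = e₂ * p₂ ∧ (e₂ = 1 ∨ e₂ = 2) ∧ 2 ≤ a₂ ∧ 3 * a₂ ≤ n))
    (h₃ : (p₃ = c₃ * a₃ ∧ n = e₃ * p₃ ∧ (e₃ = 1 ∨ e₃ = 2) ∧ 2 ≤ a₃ ∧ 3 * a₃ ≤ n))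
    (hs : n = 1 + (p₁ - c₁) + (p₂ - c₂) + (p₃ - c₃)) : e₁ = 2 := by
  have hc₁ := two_le_of_tca h₁
  have hc₂ := two_le_of_tca h₂
  have hc₃ := two_le_of_tca h₃
  have k₁ := two_mul_le_of_tca h₁
  have k₂ := two_mul_le_of_tca h₂
  have k₃ := two_mul_le_of_tca h₃
  obtain ⟨hp₁, hn₁, he₁, ha₁, -⟩ := h₁
  obtain ⟨hp₂, hn₂, he₂, ha₂, -⟩ := h₂
  obtain ⟨hp₃, hn₃, he₃, ha₃, -⟩ := h₃
  rcases he₁ with rfl | rfl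
  · rcases he₂ with rfl | rfl <;> rcases he₃ with rfl | rfl <;> omega
  · rfl

variable {G : Type*} [Group G]

/-- **A torus of index `2` in its normaliser.**  Under the hypotheses of
`card_eq_and_card_centralizer_le` (commutation transitive off the centre `Z`, every maximal torus
`C(x)`, `x ∉ Z`, of index `≤ 2` in its normaliser and of index `≥ 3` in `G`, some `x₀ ∉ Z`),
there is `x ∉ Z` with `|N(C(x))| = 2 |C(x)|` and `|G| ≤ 15 |N(C(x))|`: in every solution of the
class equation `1 - 1/n = Σᵢ (1 - 1/aᵢ)/eᵢ` some class has `eᵢ = 2`, and for it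
`cᵢ = n / (2 aᵢ) ≤ 60 / 4`. [folklore] -/
theorem exists_card_normalizer_centralizer_eq_two_mul [Finite G]
    (hCT : ∀ x y : G, x ∉ center G → y ∉ center G → y ∈ centralizer ({x} : Set G) →
      centralizer ({y} : Set G) = centralizer {x})
    (hN : ∀ x : G, x ∉ center G →
      Nat.card (normalizer (centralizer ({x} : Set G) : Set G)) ≤
        2 * Nat.card (centralizer ({x} : Set G)))
    (h3 : ∀ x : G, x ∉ center G → 3 * Nat.card (centralizer ({x} : Set G)) ≤ Nat.card G)
    {x₀ : G} (hx₀ : x₀ ∉ center G) :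
    ∃ x : G, x ∉ center G ∧
      Nat.card (normalizer (centralizer ({x} : Set G) : Set G)) =
        2 * Nat.card (centralizer ({x} : Set G)) ∧
      Nat.card G ≤ 15 * Nat.card (normalizer (centralizer ({x} : Set G) : Set G)) := by
  classical
  haveI := Fintype.ofFinite G
  set Z := center G with hZ
  set z := Nat.card Z with hz
  have hz0 : 0 < z := Nat.card_pos
  obtain ⟨n, hgn⟩ : z ∣ Nat.card G := card_subgroup_dvd_card Z
  have hg0 : 0 < Nat.card G := Nat.card_pos
  have hn0 : 0 < n := by
    rcases Nat.eq_zero_or_pos n with h | h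
    · rw [h, mul_zero] at hgn; omega
    · exact h
  set C : G → Subgroup G := fun x ↦ centralizer {x} with hC
  have hZC : ∀ x, Z ≤ C x := fun x ↦ center_le_centralizer _
  set Zf : Finset G := Finset.univ.filter (· ∈ Z) with hZf
  set X : Finset G := Finset.univ.filter (· ∉ Z) with hX
  set cls : G → Finset G := fun x ↦ X.filter (fun y ↦ C y ∈ orbit (ConjAct G) (C x)) with hcls
  set 𝒪 : Finset (Finset G) := X.image cls with h𝒪
  have hmemX : ∀ {x}, x ∈ X ↔ x ∉ Z := by simp [hX]
  have hZfcard : Zf.card = z := by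
    rw [hz, Nat.card_eq_fintype_card, ← Fintype.card_subtype]
  -- `|X| + |Z| = |G|`
  have hXn : X.card + z = z * n := by
    rw [← hgn, Nat.card_eq_fintype_card, ← Finset.card_univ, ← hZfcard, add_comm]
    exact Finset.card_filter_add_card_filter_not (fun x ↦ x ∈ Z)
  have hxC : ∀ x, x ∈ C x := fun x ↦ mem_centralizer_singleton_iff.mpr rfl
  -- fibres of `C` on `X`: `{y ∈ X | C y = C x'} = C x' ∖ Z`
  have hfiber : ∀ x', x' ∉ Z → (X.filter (fun y ↦ C y = C x')).card + z = Nat.card (C x') := by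
    intro x' hx'
    set Cf : Finset G := Finset.univ.filter (· ∈ C x') with hCf
    have hCfcard : Cf.card = Nat.card (C x') := by
      rw [Nat.card_eq_fintype_card, ← Fintype.card_subtype]
    have hset : X.filter (fun y ↦ C y = C x') = Cf \ Zf := by
      ext y
      simp only [Finset.mem_filter, Finset.mem_sdiff, Finset.mem_univ, true_and, hX, hCf, hZf]
      constructor
      · rintro ⟨hyZ, hyC⟩
        exact ⟨hyC ▸ hxC y, hyZ⟩
      · rintro ⟨hyC, hyZ⟩
        exact ⟨hyZ, hCT x' y hx' hyZ hyC⟩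
    have hsub : Zf ⊆ Cf := by
      intro y hy
      simp only [Finset.mem_filter, Finset.mem_univ, true_and, hZf, hCf] at hy ⊢
      exact hZC x' hy
    rw [hset, ← hCfcard, ← hZfcard]
    exact Finset.card_sdiff_add_card_eq_card hsub
  -- members of the orbit of `C x` are centralisers of conjugates of `x`
  have horb : ∀ x, x ∉ Z → ∀ T ∈ orbit (ConjAct G) (C x),
      ∃ x', x' ∉ Z ∧ T = C x' ∧ Nat.card T = Nat.card (C x) := by
    intro x hx T hT
    obtain ⟨k, rfl⟩ := mem_orbit_iff.mp hT
    refine ⟨ConjAct.ofConjAct k * x * (ConjAct.ofConjAct k)⁻¹, fun h ↦ hx ?_, ?_,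
      nat_card_conjAct_smul k (C x)⟩
    · have := (inferInstance : (center G).Normal).conj_mem _ h (ConjAct.ofConjAct k)⁻¹
      simpa [mul_assoc] using this
    · change k • centralizer {x} = centralizer {_}
      rw [← conjAct_smul_centralizer, ConjAct.toConjAct_ofConjAct]
  -- the size of a class: `|cls x| · |N(C x)| + |G| z = |G| · |C x|`
  have hclscard : ∀ x, x ∉ Z → (cls x).card * Nat.card (normalizer (C x : Set G)) +
      Nat.card G * z = Nat.card G * Nat.card (C x) := by
    intro x hx
    have hfin : (orbit (ConjAct G) (C x)).Finite := Set.finite_range _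
    set t : Finset (Subgroup G) := hfin.toFinset with ht
    have hmem : ∀ y ∈ cls x, C y ∈ t := by
      intro y hy
      rw [ht, Set.Finite.mem_toFinset]
      exact (Finset.mem_filter.mp hy).2
    have hsum := Finset.card_eq_sum_card_fiberwise hmem
    have hterm : ∀ T ∈ t, ((cls x).filter (fun y ↦ C y = T)).card + z = Nat.card (C x) := by
      intro T hT
      rw [ht, Set.Finite.mem_toFinset] at hT
      obtain ⟨x', hx', rfl, hcardT⟩ := horb x hx _ hT
      rw [← hcardT, ← hfiber x' hx']
      congr 2
      ext y
      simp only [hcls, Finset.mem_filter]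
      constructor
      · rintro ⟨⟨hy, -⟩, h⟩; exact ⟨hy, h⟩
      · rintro ⟨hy, h⟩; exact ⟨⟨hy, h ▸ hT⟩, h⟩
    have hsum' : (cls x).card + t.card * z = t.card * Nat.card (C x) := by
      have h1 : ∑ T ∈ t, (((cls x).filter fun y ↦ C y = T).card + z) =
          ∑ T ∈ t, Nat.card (C x) := Finset.sum_congr rfl hterm
      rw [Finset.sum_add_distrib, Finset.sum_const, Finset.sum_const, smul_eq_mul, smul_eq_mul,
        ← hsum] at h1
      exact h1
    have htcard : t.card = Nat.card (orbit (ConjAct G) (C x)) := by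
      rw [ht, ← Set.ncard_eq_toFinset_card _ hfin, Nat.card_coe_set_eq]
    have hos := nat_card_orbit_mul_card_normalizer (C x)
    rw [← htcard] at hos
    calc (cls x).card * Nat.card (normalizer (C x : Set G)) + Nat.card G * z
        = ((cls x).card + t.card * z) * Nat.card (normalizer (C x : Set G)) := by
          rw [← hos]; ring
      _ = t.card * Nat.card (C x) * Nat.card (normalizer (C x : Set G)) := by rw [hsum']
      _ = Nat.card G * Nat.card (C x) := by rw [← hos]; ring
  -- arithmetic data of the class of `x`, given `a = [C(x) : Z]`, with `e` and `c` remembered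
  have hdata : ∀ x, x ∉ Z → ∀ a, Nat.card (C x) = z * a →
      ∃ p c e, (p = c * a ∧ n = e * p ∧ (e = 1 ∨ e = 2) ∧ 2 ≤ a ∧ 3 * a ≤ n) ∧
        (cls x).card = z * (p - c) ∧
        Nat.card (normalizer (C x : Set G)) = Nat.card (C x) * e ∧
        Nat.card G = Nat.card (normalizer (C x : Set G)) * c := by
    intro x hx a ha
    obtain ⟨e, he⟩ : Nat.card (C x) ∣ Nat.card (normalizer (C x : Set G)) :=
      card_dvd_of_le le_normalizer
    obtain ⟨c, hc⟩ : Nat.card (normalizer (C x : Set G)) ∣ Nat.card G :=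
      card_subgroup_dvd_card _
    have hCpos : 0 < Nat.card (C x) := Nat.card_pos
    have ha2 : 2 ≤ a := by
      by_contra h1
      rcases Nat.eq_zero_or_pos a with h0 | h0
      · rw [h0, mul_zero] at ha; omega
      have ha1 : a = 1 := by omega
      rw [ha1, mul_one] at ha
      have : Z = C x := eq_of_le_of_card_ge (hZC x) (by rw [ha])
      exact hx (this ▸ hxC x)
    have he12 : e = 1 ∨ e = 2 := by
      have h2 := hN x hx
      rw [he] at h2
      have hle : e ≤ 2 := by
        by_contra h
        have : Nat.card (C x) * 3 ≤ Nat.card (C x) * e := Nat.mul_le_mul_left _ (by omega)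
        linarith
      have hne : e ≠ 0 := by
        rintro rfl
        have : 0 < Nat.card (normalizer (C x : Set G)) := Nat.card_pos
        rw [he, mul_zero] at this
        exact lt_irrefl _ this
      omega
    have hnz : n = a * e * c := by
      apply Nat.eq_of_mul_eq_mul_left hz0
      rw [← hgn, hc, he, ha]; ring
    have h3a : 3 * a ≤ n := by
      have := h3 x hx
      rw [ha, hgn] at this
      refine Nat.le_of_mul_le_mul_left ?_ hz0
      calc z * (3 * a) = 3 * (z * a) := by ring
        _ ≤ z * n := this
    refine ⟨c * a, c, e, ⟨rfl, by rw [hnz]; ring, he12, ha2, h3a⟩, ?_, he, hc⟩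
    have hcl := hclscard x hx
    rw [hc, he, ha] at hcl
    have hzae : 0 < z * a * e := by
      have : 0 < e := by omega
      positivity
    have key : z * a * e * ((cls x).card + z * c) = z * a * e * (z * (c * a)) := by
      calc z * a * e * ((cls x).card + z * c)
          = (cls x).card * (z * a * e) + z * a * e * c * z := by ring
        _ = z * a * e * c * (z * a) := hcl
        _ = z * a * e * (z * (c * a)) := by ring
    have key' := Nat.eq_of_mul_eq_mul_left hzae key
    rw [mul_tsub]
    omega
  -- classes: `y ∈ cls x → cls y = cls x`, `x ∈ cls x`
  have hcls_eq : ∀ x y, y ∈ cls x → cls y = cls x := by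
    intro x y hy
    have hy' : C y ∈ orbit (ConjAct G) (C x) := (Finset.mem_filter.mp hy).2
    have horbeq : orbit (ConjAct G) (C y) = orbit (ConjAct G) (C x) := orbit_eq_iff.mpr hy'
    simp only [hcls, horbeq]
  have hmem_cls : ∀ x ∈ X, x ∈ cls x := fun x hx ↦
    Finset.mem_filter.mpr ⟨hx, mem_orbit_self _⟩
  -- `X` is the disjoint union of the classes
  have hdisj : (𝒪 : Set (Finset G)).PairwiseDisjoint id := by
    intro K₁ hK₁ K₂ hK₂ hne
    obtain ⟨x₁, -, rfl⟩ := Finset.mem_image.mp (Finset.mem_coe.mp hK₁)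
    obtain ⟨x₂, -, rfl⟩ := Finset.mem_image.mp (Finset.mem_coe.mp hK₂)
    rw [Function.onFun, Finset.disjoint_left]
    intro y hy₁ hy₂
    exact hne ((hcls_eq x₁ y hy₁).symm.trans (hcls_eq x₂ y hy₂))
  have hcover : X = 𝒪.biUnion id := by
    ext y
    simp only [Finset.mem_biUnion, Finset.mem_image, h𝒪, id, exists_exists_and_eq_and]
    constructor
    · intro hy; exact ⟨y, hy, hmem_cls y hy⟩
    · rintro ⟨x, -, hyx⟩; exact (Finset.mem_filter.mp hyx).1
  have hXsum : X.card = ∑ K ∈ 𝒪, K.card := by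
    conv_lhs => rw [hcover]
    rw [Finset.card_biUnion hdisj]
    rfl
  -- arithmetic data of each class (with a representative), and each class is big
  have hrep : ∀ K ∈ 𝒪, ∃ x, x ∉ Z ∧ ∃ p c a e,
      (p = c * a ∧ n = e * p ∧ (e = 1 ∨ e = 2) ∧ 2 ≤ a ∧ 3 * a ≤ n) ∧ K.card = z * (p - c) ∧
        Nat.card (normalizer (C x : Set G)) = Nat.card (C x) * e ∧
        Nat.card G = Nat.card (normalizer (C x : Set G)) * c := by
    intro K hK
    obtain ⟨x, hx, rfl⟩ := Finset.mem_image.mp hK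
    obtain ⟨a, ha⟩ : z ∣ Nat.card (C x) := card_dvd_of_le (hZC x)
    obtain ⟨p, c, e, h, hcard, he, hc⟩ := hdata x (hmemX.mp hx) a ha
    exact ⟨x, hmemX.mp hx, p, c, a, e, h, hcard, he, hc⟩
  have hbig : ∀ K ∈ 𝒪, z * n ≤ 4 * K.card := by
    intro K hK
    obtain ⟨-, -, p, c, a, e, hT, hcard, -, -⟩ := hrep K hK
    have h2c := two_mul_le_of_tca hT
    obtain ⟨-, hn, he, -, -⟩ := hT
    have hn2 : n ≤ 2 * p := by rcases he with rfl | rfl <;> omega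
    rw [hcard]
    calc z * n ≤ z * (4 * (p - c)) := Nat.mul_le_mul_left _ (by omega)
      _ = 4 * (z * (p - c)) := by ring
  have hOcard : 𝒪.card ≤ 3 := by
    have h1 : 𝒪.card • (z * n) ≤ ∑ K ∈ 𝒪, 4 * K.card := Finset.card_nsmul_le_sum _ _ _ hbig
    rw [← Finset.mul_sum, ← hXsum, smul_eq_mul] at h1
    by_contra h
    have : 4 * (z * n) ≤ 𝒪.card * (z * n) := Nat.mul_le_mul_right _ (by omega)
    have hzn : 0 < z * n := by positivity
    omega
  -- the class of `x₀` and the other classes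
  have hx₀X : x₀ ∈ X := hmemX.mpr hx₀
  have hK₁𝒪 : cls x₀ ∈ 𝒪 := Finset.mem_image.mpr ⟨x₀, hx₀X, rfl⟩
  obtain ⟨a₀, ha₀⟩ : z ∣ Nat.card (C x₀) := card_dvd_of_le (hZC x₀)
  obtain ⟨p₁, c₁, e₁, hT₁, hK₁card, he₁, hc₁⟩ := hdata x₀ hx₀ a₀ ha₀
  have hXsum' : X.card = (cls x₀).card + ∑ K ∈ 𝒪.erase (cls x₀), K.card := by
    rw [hXsum]
    exact (Finset.add_sum_erase 𝒪 (fun K ↦ K.card) hK₁𝒪).symm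
  have h𝒪'card : (𝒪.erase (cls x₀)).card ≤ 2 := by
    rw [Finset.card_erase_of_mem hK₁𝒪]; omega
  have hrep' : ∀ K ∈ 𝒪.erase (cls x₀), ∃ x, x ∉ Z ∧ ∃ p c a e,
      (p = c * a ∧ n = e * p ∧ (e = 1 ∨ e = 2) ∧ 2 ≤ a ∧ 3 * a ≤ n) ∧ K.card = z * (p - c) ∧
        Nat.card (normalizer (C x : Set G)) = Nat.card (C x) * e ∧
        Nat.card G = Nat.card (normalizer (C x : Set G)) * c :=
    fun K hK ↦ hrep K (Finset.mem_of_mem_erase hK)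
  -- how to conclude from a class with `e = 2` and `c ≤ 15`
  have conclude : ∀ x, x ∉ Z → ∀ c,
      Nat.card (normalizer (C x : Set G)) = Nat.card (C x) * 2 →
      Nat.card G = Nat.card (normalizer (C x : Set G)) * c → c ≤ 15 →
      ∃ x : G, x ∉ center G ∧
        Nat.card (normalizer (centralizer ({x} : Set G) : Set G)) =
          2 * Nat.card (centralizer ({x} : Set G)) ∧
        Nat.card G ≤ 15 * Nat.card (normalizer (centralizer ({x} : Set G) : Set G)) := by
    intro x hx c he hc hc15
    refine ⟨x, hx, by rw [he, mul_comm], ?_⟩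
    rw [hc, mul_comm]
    exact Nat.mul_le_mul_right _ hc15
  -- case analysis on the number of other classes
  rcases Nat.lt_or_ge (𝒪.erase (cls x₀)).card 1 with h0 | h1
  · -- no other class
    have hO : 𝒪.erase (cls x₀) = ∅ := Finset.card_eq_zero.mp (by omega)
    rw [hO, Finset.sum_empty, add_zero, hK₁card] at hXsum'
    refine (false_of_one hT₁ (Nat.eq_of_mul_eq_mul_left hz0 ?_)).elim
    rw [mul_add, mul_one]
    omega
  rcases Nat.lt_or_ge (𝒪.erase (cls x₀)).card 2 with h1' | h2
  · -- one other class: `n = 12`, and the class with `e = 2` has `a ≤ 3`, `c ≤ 3`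
    obtain ⟨K₂, hO⟩ := Finset.card_eq_one.mp (show (𝒪.erase (cls x₀)).card = 1 by omega)
    obtain ⟨x₂, hx₂, p₂, c₂, a₂, e₂, hT₂, hK₂, he₂, hc₂⟩ := hrep' K₂ (by rw [hO]; simp)
    rw [hO, Finset.sum_singleton, hK₁card, hK₂] at hXsum'
    have hs : n = 1 + (p₁ - c₁) + (p₂ - c₂) :=
      Nat.eq_of_mul_eq_mul_left hz0 (by rw [mul_add, mul_add, mul_one]; omega)
    obtain ⟨hn12, ha₁3, ha₂3⟩ := eq_twelve_of_two hT₁ hT₂ hs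
    rcases exists_e_eq_two_of_two hT₁ hT₂ hs with rfl | rfl
    · obtain ⟨hp, hn, -, ha, -⟩ := hT₁
      refine conclude x₀ hx₀ c₁ he₁ hc₁ ?_
      interval_cases a₀ <;> omega
    · obtain ⟨hp, hn, -, ha, -⟩ := hT₂
      refine conclude x₂ hx₂ c₂ he₂ hc₂ ?_
      interval_cases a₂ <;> omega
  · -- two other classes: all `e = 2`, `n ∈ {12, 24, 60}`, `a₀ ≤ 5`, `c₁ = n / (2 a₀) ≤ 15`
    obtain ⟨K₂, K₃, hne, hO⟩ :=
      Finset.card_eq_two.mp (show (𝒪.erase (cls x₀)).card = 2 by omega)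
    obtain ⟨x₂, -, p₂, c₂, a₂, e₂, hT₂, hK₂, -, -⟩ := hrep' K₂ (by rw [hO]; simp)
    obtain ⟨x₃, -, p₃, c₃, a₃, e₃, hT₃, hK₃, -, -⟩ := hrep' K₃ (by rw [hO]; simp)
    rw [hO, Finset.sum_pair hne, hK₁card, hK₂, hK₃] at hXsum'
    have hs : n = 1 + (p₁ - c₁) + (p₂ - c₂) + (p₃ - c₃) :=
      Nat.eq_of_mul_eq_mul_left hz0 (by rw [mul_add, mul_add, mul_add, mul_one]; omega)
    obtain ⟨hn, ha₁, -, -⟩ := solve_three hT₁ hT₂ hT₃ hs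
    have he2 : e₁ = 2 := e_eq_two_of_three hT₁ hT₂ hT₃ hs
    subst he2
    obtain ⟨hp, hn', -, ha, -⟩ := hT₁
    refine conclude x₀ hx₀ c₁ he₁ hc₁ ?_
    interval_cases a₀ <;> rcases hn with h | h | h <;> omega

end Literature.NumberTheory.GaloisRepresentations.Serre1972.Counting

/-! ## Subgroups of `GL₂(𝔽_p)` of order prime to `p`, and the `SL₂`-criterion -/

namespace Literature.NumberTheory.GaloisRepresentations.Serre1972

open DeligneSerre1974

variable {p : ℕ} [Fact p.Prime]

/-- **Serre 1972, n° 2.6, a torus of index `2` in its normaliser.**  Let `p` be odd and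
`G ≤ GL₂(𝔽_p)` non-abelian of order prime to `p`.  Then some maximal torus `T = C_G(x)`,
`x ∉ Z(G)`, has `|N_G(T)| = 2 |T|` and `[G : N_G(T)] ≤ 15`: in case ii) of n° 2.6 (a torus of
index `≤ 2`) the torus is normal of index exactly `2`; in case iii) (`G/Z ≅ 𝔄₄, 𝔖₄, 𝔄₅`) this
is `Counting.exists_card_normalizer_centralizer_eq_two_mul` (e.g. the three cyclic subgroups of
the Klein group of `𝔄₄`, of normaliser the Klein group). [cite: Serre1972, §2.6] -/
theorem exists_card_normalizer_centralizer_eq_two_mul (G : Subgroup (GL (Fin 2) (ZMod p)))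
    (hp2 : p ≠ 2) (hG : ¬ p ∣ Nat.card G) (hab : ¬ ∀ a b : G, a * b = b * a) :
    ∃ x : G, x ∉ Subgroup.center G ∧
      Nat.card (Subgroup.normalizer (Subgroup.centralizer ({x} : Set G) : Set G)) =
        2 * Nat.card (Subgroup.centralizer ({x} : Set G)) ∧
      Nat.card G ≤
        15 * Nat.card (Subgroup.normalizer (Subgroup.centralizer ({x} : Set G) : Set G)) := by
  classical
  haveI : Fintype G := Fintype.ofFinite G
  have h2 : (2 : ZMod p) ≠ 0 := two_ne_zero_of_ne_two hp2
  by_cases hii : ∃ x : G, x ∉ Subgroup.center G ∧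
      Nat.card G ≤ 2 * Nat.card (Subgroup.centralizer ({x} : Set G))
  · -- case ii): the torus is normal of index `2`
    obtain ⟨x, hx, hle⟩ := hii
    set T : Subgroup G := Subgroup.centralizer ({x} : Set G) with hT
    have hTn : T.Normal := normal_centralizer_of_card_le_two_mul hle
    have hNtop : Subgroup.normalizer (T : Set G) = ⊤ := Subgroup.normalizer_eq_top_iff.mpr hTn
    have hcardN : Nat.card (Subgroup.normalizer (T : Set G)) = Nat.card G := by
      rw [hNtop, Subgroup.card_top]
    have hTne : T ≠ ⊤ := by
      intro htop
      apply hx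
      rw [Subgroup.mem_center_iff]
      intro g
      have hg : g ∈ T := htop ▸ Subgroup.mem_top g
      exact Subgroup.mem_centralizer_singleton_iff.mp hg
    have hge : 2 * Nat.card T ≤ Nat.card G := by
      have hmul := T.card_mul_index
      have hi1 : T.index ≠ 1 := fun h ↦ hTne (Subgroup.index_eq_one.mp h)
      have hi0 : T.index ≠ 0 := Subgroup.index_ne_zero_of_finite
      have hi2 : 2 ≤ T.index := by omega
      calc 2 * Nat.card T = Nat.card T * 2 := mul_comm _ _
        _ ≤ Nat.card T * T.index := Nat.mul_le_mul_left _ hi2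
        _ = Nat.card G := hmul
    refine ⟨x, hx, ?_, ?_⟩
    · rw [← hT, hcardN]; omega
    · rw [← hT, hcardN]; omega
  · -- case iii): the class equation
    push Not at hii
    have hCT : ∀ x y : G, x ∉ Subgroup.center G → y ∉ Subgroup.center G →
        y ∈ Subgroup.centralizer ({x} : Set G) →
          Subgroup.centralizer ({y} : Set G) = Subgroup.centralizer {x} :=
      fun x y hx hy hyx ↦ centralizer_eq_of_mem hx hy hyx
    have hN : ∀ x : G, x ∉ Subgroup.center G →
        Nat.card (Subgroup.normalizer (Subgroup.centralizer ({x} : Set G) : Set G)) ≤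
          2 * Nat.card (Subgroup.centralizer ({x} : Set G)) :=
      fun x hx ↦ card_normalizer_centralizer_le h2 hG hx
    have h3 : ∀ x : G, x ∉ Subgroup.center G →
        3 * Nat.card (Subgroup.centralizer ({x} : Set G)) ≤ Nat.card G := by
      intro x hx
      obtain ⟨k, hk⟩ : Nat.card (Subgroup.centralizer ({x} : Set G)) ∣ Nat.card G :=
        Subgroup.card_subgroup_dvd_card _
      have hlt := hii x hx
      rw [hk] at hlt ⊢
      have hk3 : 3 ≤ k := by
        by_contra hk3
        push Not at hk3
        interval_cases k <;> omega
      calc 3 * Nat.card (Subgroup.centralizer ({x} : Set G))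
          ≤ k * Nat.card (Subgroup.centralizer ({x} : Set G)) := Nat.mul_le_mul_right _ hk3
        _ = Nat.card (Subgroup.centralizer ({x} : Set G)) * k := mul_comm _ _
    obtain ⟨x₁, hx₁⟩ : ∃ x : G, x ∉ Subgroup.center G := by
      by_contra hall
      push Not at hall
      exact hab fun a b ↦ (Subgroup.mem_center_iff.mp (hall a) b).symm
    exact Counting.exists_card_normalizer_centralizer_eq_two_mul hCT hN h3 hx₁

/-- **`N_G(C_G(x))` normalises the Cartan subgroup `𝔽_p[x]ˣ`** (n° 2.2 / 2.6 ii): for a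
non-scalar `x ∈ G ≤ GL₂(F)` and `k ∈ N_G(C_G(x))`, `k x k⁻¹ ∈ C_G(x) ⊆ F[x]` is non-scalar, so
`k F[x] k⁻¹ = F[k x k⁻¹] = F[x]` (same computation as `le_normalizer_unitGroup_adjoinElem`, which
is the case `N_G(C_G(x)) = G`). [cite: Serre1972, §2.6] -/
theorem map_normalizer_centralizer_le_normalizer {F : Type*} [Field F]
    {G : Subgroup (GL (Fin 2) F)} {x : G} (hxs : ∀ c : F, x.1.1 ≠ c • 1) :
    (Subgroup.normalizer (Subgroup.centralizer ({x} : Set G) : Set G)).map G.subtype ≤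
      Subgroup.normalizer (unitGroup (adjoinElem x.1.1) : Set (GL (Fin 2) F)) := by
  -- `F[k x k⁻¹] = F[x]` for `k ∈ N_G(C_G(x))`
  have key : ∀ k : G, k ∈ Subgroup.normalizer (Subgroup.centralizer ({x} : Set G) : Set G) →
      adjoinElem (k.1.1 * x.1.1 * (k.1.1)⁻¹) = adjoinElem x.1.1 := by
    intro k hk
    have hmem : k * x * k⁻¹ ∈ Subgroup.centralizer ({x} : Set G) :=
      (Subgroup.mem_normalizer_iff.mp hk x).mp (Subgroup.mem_centralizer_singleton_iff.mpr rfl)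
    have hcomm : x.1.1 * (k * x * k⁻¹).1.1 = (k * x * k⁻¹).1.1 * x.1.1 := by
      have h := Subgroup.mem_centralizer_singleton_iff.mp hmem
      have := congrArg (fun g : G ↦ g.1.1) h
      simpa only [Subgroup.coe_mul, Units.val_mul] using this.symm
    obtain ⟨a, b, hab⟩ := DeligneSerre1974.TwoByTwo.exists_eq_smul_one_add_smul_of_commute hxs hcomm
    have hmat : (k * x * k⁻¹).1.1 = k.1.1 * x.1.1 * (k.1.1)⁻¹ := by
      simp only [Subgroup.coe_mul, Subgroup.coe_inv, Units.val_mul, Matrix.coe_units_inv]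
    have hns : ∀ c : F, (k * x * k⁻¹).1.1 ≠ c • 1 := by
      intro c hc
      apply hxs c
      have hku : IsUnit (k.1.1).det := (GL2.det_ne_zero k.1).isUnit
      rw [hmat] at hc
      calc x.1.1 = (k.1.1)⁻¹ * (k.1.1 * x.1.1 * (k.1.1)⁻¹) * k.1.1 := (conj_cancel' _ hku _).symm
        _ = c • 1 := by rw [hc, Matrix.mul_smul, Matrix.mul_one, Matrix.smul_mul,
              Matrix.nonsing_inv_mul _ hku]
    rw [← hmat]
    exact adjoinElem_eq_of_mem ⟨a, b, hab⟩ hns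
  rintro g ⟨k, hk, rfl⟩
  change (k : GL (Fin 2) F) ∈
    Subgroup.normalizer (unitGroup (adjoinElem x.1.1) : Set (GL (Fin 2) F))
  rw [Subgroup.mem_normalizer_iff]
  have hgu : IsUnit (k.1 : Matrix (Fin 2) (Fin 2) F).det := (GL2.det_ne_zero k.1).isUnit
  intro h
  simp only [mem_unitGroup_iff, Units.val_mul, Matrix.coe_units_inv]
  constructor
  · intro hh
    have := conj_mem_adjoinElem hh (Matrix.mul_nonsing_inv _ hgu)
    rwa [key k hk] at this
  · intro hh
    have := conj_mem_adjoinElem hh (Matrix.nonsing_inv_mul _ hgu)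
    rw [conj_cancel' _ hgu] at this
    have key' := key k⁻¹ ((Subgroup.normalizer _).inv_mem hk)
    simp only [Subgroup.coe_inv, Matrix.coe_units_inv, Matrix.nonsing_inv_nonsing_inv _ hgu]
      at key'
    rwa [key'] at this

/-- **The `SL₂`-criterion in normaliser form** (the group theory of Masser–Wüstholz 1993 §4 with
Serre 1972 §4.2 c) in place of Lemma 3.2).  Let `p` be an odd prime and `G ≤ GL₂(𝔽_p)` such that
(1) `G` fixes no line; (2) `G` contains an element `c` with `c² = 1`, `det c = -1`; (3) every
subgroup `H ≤ G` of index `≤ 60` which is contained in the normaliser of a Cartan subgroup `C`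
is contained in `C`.  Then `G ⊇ SL₂(𝔽_p)`.  If `p ∣ |G|` this is Prop. 15 with (1).  If
`p ∤ |G|` and `G` is abelian, `G ⊆ 𝔽_p[c]ˣ` (a Cartan subgroup, `c` being non-scalar as
`det c = -1` is not a square of `±1`… rather `c = t·1` would give `det c = t² = 1`), and a Cartan
subgroup containing `c` is split with `G` in a Borel subgroup
(`exists_le_eigenvectorStabilizer_of_le_cartan`), against (1).  If `G` is non-abelian,
`exists_card_normalizer_centralizer_eq_two_mul` gives a torus `T = C_G(x)` with
`[N_G(T) : T] = 2`, `[G : N_G(T)] ≤ 15`; `H = N_G(T)` normalises the Cartan subgroup `𝔽_p[x]ˣ`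
(`map_normalizer_centralizer_le_normalizer`) and is not inside it (its elements inside `𝔽_p[x]ˣ`
commute with `x`, i.e. lie in `T`), against (3).
[cite: Serre1972, §2.6 and §4.2 c)] -/
theorem ker_det_le_of_forall_le_normalizer_imp_le (G : Subgroup (GL (Fin 2) (ZMod p)))
    (hp2 : p ≠ 2)
    (h1 : ∀ (v : Fin 2 → ZMod p) (hv : v ≠ 0), ¬ G ≤ eigenvectorStabilizer v hv)
    {c : GL (Fin 2) (ZMod p)} (hcG : c ∈ G) (hc : c * c = 1)
    (hdet : Matrix.det (c : Matrix (Fin 2) (Fin 2) (ZMod p)) = -1)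
    (h2 : ∀ H : Subgroup G, H.index ≤ 60 → ∀ C ∈ cartanSubgroups (ZMod p),
      H.map G.subtype ≤ Subgroup.normalizer (C : Set (GL (Fin 2) (ZMod p))) →
        H.map G.subtype ≤ C) :
    (GeneralLinearGroup.det : GL (Fin 2) (ZMod p) →* (ZMod p)ˣ).ker ≤ G := by
  classical
  by_cases hdvd : p ∣ Nat.card G
  · rcases ker_det_le_or_exists_eigenvector_of_dvd_card G hdvd with h | ⟨v, hv, hB⟩
    · exact h
    · exact absurd (fun g hg ↦ mem_eigenvectorStabilizer_iff.mpr (hB g hg)) (h1 v hv)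
  · exfalso
    have htwo : (2 : ZMod p) ≠ 0 := two_ne_zero_of_ne_two hp2
    by_cases hab : ∀ a b : G, a * b = b * a
    · -- `G` abelian: inside the Cartan subgroup `𝔽_p[c]ˣ`, hence in a Borel subgroup
      set y : G := ⟨c, hcG⟩ with hy
      have hys : ∀ t : ZMod p, y.1.1 ≠ t • 1 := by
        intro t ht
        have hval : (c : Matrix (Fin 2) (Fin 2) (ZMod p)) = t • 1 := ht
        have hcc : (c : Matrix (Fin 2) (Fin 2) (ZMod p)) * c = 1 := by
          rw [← Units.val_mul, hc, Units.val_one]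
        have ht2 : t * t = 1 := by
          have h00 := congrArg (fun M : Matrix (Fin 2) (Fin 2) (ZMod p) ↦ M 0 0) hcc
          simpa [hval, Matrix.smul_apply, Matrix.one_apply] using h00
        have hd : Matrix.det (c : Matrix (Fin 2) (Fin 2) (ZMod p)) = t * t := by
          rw [hval, Matrix.det_smul, Matrix.det_one, mul_one, Fintype.card_fin, pow_two]
        rw [hd, ht2] at hdet
        apply htwo
        linear_combination hdet
      have hdisc : (y.1.1).trace ^ 2 - 4 * (y.1.1).det ≠ 0 :=
        TwoByTwo.disc_ne_zero_of_pow_eq_one htwo hys (det_mat_ne_zero y) (m := Nat.card G)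
          (by rwa [Ne, ZMod.natCast_eq_zero_iff]) (by rw [← mat_pow, pow_card_eq_one', mat_one])
      have hC' := unitGroup_adjoinElem_mem_cartanSubgroups hys hdisc
      have hGC' : G ≤ unitGroup (adjoinElem y.1.1) := le_unitGroup_adjoinElem_of_comm hab hys
      obtain ⟨v, hv, hB⟩ := exists_le_eigenvectorStabilizer_of_le_cartan hp2 hC' hGC' hcG hc hdet
      exact h1 v hv hB
    · -- `G` non-abelian: the torus `T = C_G(x)` with `[N_G(T) : T] = 2`, `[G : N_G(T)] ≤ 15`
      obtain ⟨x, hx, hN2, hN15⟩ := exists_card_normalizer_centralizer_eq_two_mul G hp2 hdvd hab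
      set T : Subgroup G := Subgroup.centralizer ({x} : Set G) with hT
      set H : Subgroup G := Subgroup.normalizer (T : Set G) with hH
      obtain ⟨hxs, hdisc⟩ := nonscalar_of_not_mem_center htwo hdvd hx
      have hC' := unitGroup_adjoinElem_mem_cartanSubgroups hxs hdisc
      have hHi : H.index ≤ 60 := by
        have hmul := H.card_mul_index
        have hpos : 0 < Nat.card H := Nat.card_pos
        by_contra hlt
        have : Nat.card H * 61 ≤ Nat.card H * H.index := Nat.mul_le_mul_left _ (by omega)
        omega
      have hHN := map_normalizer_centralizer_le_normalizer (G := G) hxs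
      have hHC : ¬ H.map G.subtype ≤ unitGroup (adjoinElem x.1.1) := by
        intro hle
        have hHT : H ≤ T := by
          intro h hh
          have hmem : (h : GL (Fin 2) (ZMod p)) ∈ unitGroup (adjoinElem x.1.1) :=
            hle ⟨h, hh, rfl⟩
          obtain ⟨a, b, hab'⟩ := mem_adjoinElem_iff.mp (mem_unitGroup_iff.mp hmem)
          rw [hT, Subgroup.mem_centralizer_singleton_iff, commute_iff_mat]
          exact mul_eq_mul_of_eq_smul_one_add_smul hab' rfl
        have hle' : Nat.card H ≤ Nat.card T := Subgroup.card_le_of_le hHT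
        have hTpos : 0 < Nat.card T := Nat.card_pos
        omega
      exact hHC (h2 H hHi _ hC' hHN)

end Literature.NumberTheory.GaloisRepresentations.Serre1972
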